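import Mathlib
import Literature.Analysis.FluidPDE.TypeIAncientMild
import Literature.Analysis.FluidPDE.TypeIAncientMildClassical
import Literature.Analysis.FluidPDE.TsaiSelfSimilarBounded
import Literature.Analysis.FluidPDE.BarkerPrange2020VorticityAlignmentTypeIHolds
import Summits.NavierStokesRegularity.NavierStokesRegularity.Theses.SymmetryModuliCount
import Summits.NavierStokesRegularity.NavierStokesRegularity.Theorems.ClockStretchingLawClockCeilingGermRigidity
import Summits.NavierStokesRegularity.NavierStokesRegularity.Theorems.ScenarioCensusPeriodicGauge
import Summits.NavierStokesRegularity.NavierStokesRegularity.Theorems.SymmetryModuliCountForcedSymmetryInteriorVertexVanishing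
import Summits.NavierStokesRegularity.NavierStokesRegularity.Theorems.SymmetryModuliCountForcedSymmetryRigidComotionVanishing
import HarnessLib

/-!
# Block A2, instrument GENERATOR METER (ns-idea-2 LINE g17-3; cells A2gnS / A2gn0 / A2gnP / A2gnTf / A2gn2 DECIDED, A2gnE / A2gnT OPEN) — port, part 1/4: §A the extended-generator reading on
# ONE slice; §A′ the finite model (the generator table is a partition); §B one germ reads the whole slice (real-analyticity of the reading); §C which generators the profile dictionary decides

Re-homed for the scenario census (typer seat ns-census-typer-1 g10; the cells A2gnS / A2gn0 / A2gnP / A2gnTf / A2gn2 are MEMBERS OF RECORD «DECIDED IN KERNEL IN FILES» of row A2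
(item 84: critic idea-crit-3 g10 PASS 12:19:42Z; ref PRE-CHECK ✓ §19.13; lead label Pineau–Vicol arXiv:2607.09619 Thm 1.9), A2gnE / A2gnT OPEN (typed); this port makes the decided cells
TREE-decided): VERBATIM PORT of ns-idea-2 LINE g17-3 «generator-meter», `pub/ideators/ns-idea-2/lines/generator-meter/line-generator-meter.lean` sha16 71227eedda12bed6 (934 l.,
lean check rc 0, 0 sorry), split for the 400-line rule into `ScenarioCensusGeneratorMeter` (§A–§C) → `…GeneratorMeterScaling` (§D–§F) → `…GeneratorMeterRank` (§F′–§G) →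
`…GeneratorMeterRows` (§I–§J + census KEYS).  Lean text VERBATIM in namespace `…Theorems.ScenarioCensus.GeneratorMeter` (the line's `…Lines.GeneratorMeter` re-homed); port
edits: the line's `local notation "E3"` is spelled as the reducible `abbrev E3` of every census file; `@[conjecture]` on the OPEN rows `Row_A2gnE`, `Row_A2gnT`; one-line docstrings
added where missing (gate lint).  Statements untouched.

No census VALUE is moved here (row A2 stays OPEN-WITH-LINE; the members become TREE-decided by name); (L′) is NOT proved; no summit statement is proved by this file.
-/

-- the summit and its single problem share the name `NavierStokesRegularity` (D-0017 nested layout)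
set_option linter.dupNamespace false

noncomputable section

open Set Function Filter Metric
open scoped Topology
open Literature.Analysis Literature.Analysis.FluidPDE
open Summit.NavierStokesRegularity.NavierStokesRegularity.Theorems

namespace Summit.NavierStokesRegularity.NavierStokesRegularity.Theorems.ScenarioCensus.GeneratorMeter

/-- `ℝ³` (the line's `local notation "E3"`, spelled as a reducible abbreviation for the tree). -/
abbrev E3 := EuclideanSpace ℝ (Fin 3)

-- the summit namespace `…NavierStokesRegularity.NavierStokesRegularity…` is the tree convention (D-0017)

variable {C : ℝ} {u : ℝ → E3 → E3}

/-! ## A. The instrument: the extended-generator reading on ONE slice -/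

/-- The READING of the generator `(a, σ, τ)` of the parabolic similarity algebra (translations `a`,
scaling `σ`, time shift `τ`; no rotation part) on the field `u` at the space-time point `(t, x)`:
`𝒢 u (t,x) = D(u t)(x)[a + σx] + σ u(t,x) + (2σt + τ) ∂ₜu(t,x)` — the tree's normal form
(`SymmetryModuliCountForcedSymmetryResidual`, with `A = 0`), read here at ONE instant. -/
def genReading (a : E3) (σ τ : ℝ) (u : ℝ → E3 → E3) (t : ℝ) (x : E3) : E3 :=
  fderiv ℝ (u t) x (a + σ • x) + σ • u t x + (2 * σ * t + τ) • timeDeriv u t x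

/-- The generator reading, unfolded. -/
theorem genReading_apply (a : E3) (σ τ : ℝ) (u : ℝ → E3 → E3) (t : ℝ) (x : E3) :
    genReading a σ τ u t x =
      fderiv ℝ (u t) x (a + σ • x) + σ • u t x + (2 * σ * t + τ) • timeDeriv u t x := rfl

/-- The zero field reads zero. -/
theorem genReading_zero_field (a : E3) (σ τ t : ℝ) (x : E3) :
    genReading a σ τ (fun _ _ => (0 : E3)) t x = 0 := by
  simp [genReading, timeDeriv]

/-- Dictionary: translating the field by `c` shifts the translation part of the generator,
`𝒢_{a,σ,τ}[u(·, · + c)](t, y) = 𝒢_{a − σc, σ, τ}[u](t, y + c)`. -/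
theorem genReading_translate (a c : E3) (σ τ : ℝ) (u : ℝ → E3 → E3) (t : ℝ) (y : E3) :
    genReading a σ τ (fun s z => u s (z + c)) t y = genReading (a - σ • c) σ τ u t (y + c) := by
  simp only [genReading, timeDeriv]
  have h : fderiv ℝ (fun z => u t (z + c)) y = fderiv ℝ (u t) (y + c) := fderiv_comp_add_right c
  rw [h]
  congr 2
  simp only [smul_add, sub_add_add_cancel]

/-- **The reading is LINEAR in the generator**: the annihilator of a germ is a linear subspace of the
5-dimensional algebra `(a, σ, τ)`. -/
theorem genReading_comb (r s : ℝ) (a₁ a₂ : E3) (σ₁ σ₂ τ₁ τ₂ : ℝ) (u : ℝ → E3 → E3) (t : ℝ) (x : E3) :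
    genReading (r • a₁ + s • a₂) (r * σ₁ + s * σ₂) (r * τ₁ + s * τ₂) u t x =
      r • genReading a₁ σ₁ τ₁ u t x + s • genReading a₂ σ₂ τ₂ u t x := by
  simp only [genReading]
  have h1 : r • a₁ + s • a₂ + (r * σ₁ + s * σ₂) • x = r • (a₁ + σ₁ • x) + s • (a₂ + σ₂ • x) := by
    rw [add_smul, mul_smul, mul_smul, smul_add, smul_add]; abel
  have h2 : 2 * (r * σ₁ + s * σ₂) * t + (r * τ₁ + s * τ₂) =
      r * (2 * σ₁ * t + τ₁) + s * (2 * σ₂ * t + τ₂) := by ring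
  rw [h1, h2, map_add, map_smul, map_smul, add_smul, mul_smul, mul_smul, add_smul, mul_smul, mul_smul,
    smul_add, smul_add, smul_add, smul_add]
  abel

/-! ## A′. The finite model: the generator table is a partition -/

/-- **THE TABLE IS EXHAUSTIVE.** For a generator `(a, σ, τ)` and a slice time `t₁`, exactly the five
cells of the generator meter occur: scaling with vertex in the FUTURE of the slice (decided, Tsai),
ON the slice (decided, kinematic), in its PAST (open: expander slice); drift `σ = 0`, `τ ≠ 0` (open:
frozen / travelling instant); translation `σ = 0 = τ` (decided for `a ≠ 0`; the zero generator reads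
nothing). -/
theorem genTable (σ τ t₁ : ℝ) :
    (σ ≠ 0 ∧ σ * (2 * σ * t₁ + τ) < 0) ∨ (σ ≠ 0 ∧ 2 * σ * t₁ + τ = 0) ∨
      (σ ≠ 0 ∧ 0 < σ * (2 * σ * t₁ + τ)) ∨ (σ = 0 ∧ τ ≠ 0) ∨ (σ = 0 ∧ τ = 0) := by
  by_cases hσ : σ = 0
  · by_cases hτ : τ = 0
    · exact Or.inr (Or.inr (Or.inr (Or.inr ⟨hσ, hτ⟩)))
    · exact Or.inr (Or.inr (Or.inr (Or.inl ⟨hσ, hτ⟩)))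
  · rcases lt_trichotomy (σ * (2 * σ * t₁ + τ)) 0 with hlt | heq | hgt
    · exact Or.inl ⟨hσ, hlt⟩
    · refine Or.inr (Or.inl ⟨hσ, ?_⟩)
      rcases mul_eq_zero.1 heq with h | h
      · exact absurd h hσ
      · exact h
    · exact Or.inr (Or.inr (Or.inl ⟨hσ, hgt⟩))

/-! ## B. One germ reads the whole slice (real-analyticity of the reading) -/

/-- Evaluation `y ↦ F(y)[g(y)]` of an analytic operator-valued map at an analytic argument is
analytic (the evaluation pairing is a continuous bilinear map). -/
theorem analyticAt_clm_apply {X Y Z : Type*} [NormedAddCommGroup X] [NormedSpace ℝ X]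
    [NormedAddCommGroup Y] [NormedSpace ℝ Y] [NormedAddCommGroup Z] [NormedSpace ℝ Z]
    {F : X → Y →L[ℝ] Z} {g : X → Y} {x : X} (hF : AnalyticAt ℝ F x) (hg : AnalyticAt ℝ g x) :
    AnalyticAt ℝ (fun y => F y (g y)) x := by
  have hB : AnalyticAt ℝ (fun p : (Y →L[ℝ] Z) × Y => (ContinuousLinearMap.id ℝ (Y →L[ℝ] Z)) p.1 p.2)
      (F x, g x) :=
    (ContinuousLinearMap.id ℝ (Y →L[ℝ] Z)).analyticAt_bilinear (F x, g x)
  have hP : AnalyticAt ℝ (fun y => (F y, g y)) x := hF.prod hg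
  exact AnalyticAt.comp (f := fun y => (F y, g y)) (x := x) hB hP

/-- The time derivative of a class element at `(t, x)`, `t < 0`, is the partial derivative of the
jointly analytic `uncurry u` in the time direction. -/
theorem timeDeriv_eq_fderiv_uncurry (hu : IsTypeIAncientMild C u) {t : ℝ} (ht : t < 0) (x : E3) :
    timeDeriv u t x = fderiv ℝ (uncurry u) (t, x) ((1 : ℝ), (0 : E3)) := by
  have hA : AnalyticAt ℝ (uncurry u) (t, x) :=
    openSetLiouville_analyticOnNhd_uncurry hu (t, x) ⟨mem_Iio.2 ht, mem_univ _⟩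
  have hF : HasFDerivAt (uncurry u) (fderiv ℝ (uncurry u) (t, x)) (t, x) :=
    hA.differentiableAt.hasFDerivAt
  have hγ : HasDerivAt (fun s : ℝ => ((s, x) : ℝ × E3)) ((1 : ℝ), (0 : E3)) t :=
    (hasDerivAt_id t).prodMk (hasDerivAt_const t x)
  have hcomp := hF.comp_hasDerivAt t hγ
  have e : (uncurry u ∘ fun s : ℝ => ((s, x) : ℝ × E3)) = fun s => u s x := by
    funext s; rfl
  rw [e] at hcomp
  simpa [timeDeriv] using hcomp.deriv

/-- The slice `x ↦ ∂ₜu(t, x)` is real-analytic. -/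
theorem analyticOnNhd_timeDeriv (hu : IsTypeIAncientMild C u) {t : ℝ} (ht : t < 0) :
    AnalyticOnNhd ℝ (fun x => timeDeriv u t x) univ := by
  intro x _
  have hAll := openSetLiouville_analyticOnNhd_uncurry hu
  have hD : AnalyticOnNhd ℝ (fderiv ℝ (uncurry u)) (Iio 0 ×ˢ (univ : Set E3)) := hAll.fderiv
  have hι : AnalyticAt ℝ (fun y : E3 => ((t, y) : ℝ × E3)) x :=
    (analyticAt_const (v := t)).prod (analyticOnNhd_id (𝕜 := ℝ) (s := univ) x (mem_univ x))
  have h1 : AnalyticAt ℝ (fun y : E3 => fderiv ℝ (uncurry u) (t, y)) x :=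
    (hD (t, x) ⟨mem_Iio.2 ht, mem_univ _⟩).comp hι
  have h2 : AnalyticAt ℝ (fun y : E3 => fderiv ℝ (uncurry u) (t, y) ((1 : ℝ), (0 : E3))) x :=
    analyticAt_clm_apply h1 analyticAt_const
  have e : (fun y => timeDeriv u t y) = fun y : E3 => fderiv ℝ (uncurry u) (t, y) ((1 : ℝ), (0 : E3)) := by
    funext y; exact timeDeriv_eq_fderiv_uncurry hu ht y
  rw [e]; exact h2

/-- The reading of any generator on a slice of a class element is real-analytic: the slice is
(`IsTypeIAncientMild.analyticOnNhd_slice_univ`), so is its Fréchet derivative evaluated along the affine field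
`a + σx`, and so is the clock mode `∂ₜu(t, ·)` (`analyticOnNhd_timeDeriv`, from the tree's joint analyticity
`openSetLiouville_analyticOnNhd_uncurry`; the tree's `openSetSteadyLiouville_analyticOnNhd_timeDeriv_slice` is the same fact). -/
theorem analyticOnNhd_genReading (hu : IsTypeIAncientMild C u) (a : E3) (σ τ : ℝ) {t : ℝ}
    (ht : t < 0) : AnalyticOnNhd ℝ (genReading a σ τ u t) univ := by
  have hs : AnalyticOnNhd ℝ (u t) univ := hu.analyticOnNhd_slice_univ ht
  have hD : AnalyticOnNhd ℝ (fderiv ℝ (u t)) univ := hs.fderiv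
  have hv : AnalyticOnNhd ℝ (fun x : E3 => a + σ • x) univ := fun x _ =>
    analyticAt_const.add ((analyticAt_const (v := σ)).smul (analyticOnNhd_id (𝕜 := ℝ) x (mem_univ x)))
  have h1 : AnalyticOnNhd ℝ (fun x => fderiv ℝ (u t) x (a + σ • x)) univ := fun x hx =>
    analyticAt_clm_apply (hD x hx) (hv x hx)
  have h2 : AnalyticOnNhd ℝ (fun x => σ • u t x) univ := fun x hx =>
    (analyticAt_const (v := σ)).smul (hs x hx)
  have h3 : AnalyticOnNhd ℝ (fun x => (2 * σ * t + τ) • timeDeriv u t x) univ := fun x hx =>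
    (analyticAt_const (v := 2 * σ * t + τ)).smul (analyticOnNhd_timeDeriv hu ht x hx)
  have e : genReading a σ τ u t = fun x =>
      fderiv ℝ (u t) x (a + σ • x) + σ • u t x + (2 * σ * t + τ) • timeDeriv u t x := rfl
  rw [e]
  exact (h1.add h2).add h3

/-- **One germ reads the whole slice**: if a generator reading vanishes on a nonempty open set of
ONE slice `t < 0` of a class element, it vanishes on the whole slice (identity theorem). -/
theorem genReading_eq_zero_of_germ (hu : IsTypeIAncientMild C u) {a : E3} {σ τ t : ℝ} (ht : t < 0)
    {U : Set E3} (hU : IsOpen U) (hne : U.Nonempty) (h : ∀ x ∈ U, genReading a σ τ u t x = 0)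
    (x : E3) : genReading a σ τ u t x = 0 := by
  obtain ⟨z, hz⟩ := hne
  have hev : genReading a σ τ u t =ᶠ[𝓝 z] 0 :=
    Filter.eventually_of_mem (hU.mem_nhds hz) fun y hy => by simpa using h y hy
  have := (analyticOnNhd_genReading hu a σ τ ht).eqOn_zero_of_preconnected_of_eventuallyEq_zero
    isPreconnected_univ (mem_univ z) hev
  simpa using this (mem_univ x)

/-! ## C. The finite model: which generators the profile dictionary decides -/

/-- **Profile dictionary (scaling, vertex in the FUTURE of the slice).** If the normalised scaling
reading `D U[y] + U + κ ∂ₜu = 0` vanishes on the whole slice `t₁` with `κ < 0` (vertex time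
`θ = t₁ − κ/2 > t₁`), then the slice `U = u(t₁, ·)` with the classical pressure of the class is a
bounded LERAY PROFILE with `a = −1/κ > 0`, `ν = 1`. -/
theorem lerayProfile_of_scalingSlice (hu : IsTypeIAncientMild C u) {t₁ : ℝ} (ht₁ : t₁ < 0)
    {κ : ℝ} (hκ : κ < 0)
    (h : ∀ y, fderiv ℝ (u t₁) y y + u t₁ y + κ • timeDeriv u t₁ y = 0) :
    ∃ P : E3 → ℝ, IsLerayProfile 1 (-κ⁻¹) (u t₁) P := by
  obtain ⟨p, hp⟩ := hu.exists_isClassicalNSSolutionOn_Ioo (t₀ := 2 * t₁) (by linarith)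
  have hmem : t₁ ∈ Ioo (2 * t₁) 0 := ⟨by linarith, ht₁⟩
  refine ⟨p t₁, ?_, ?_, ?_, hu.isDivFree ht₁⟩
  · exact (hu.contDiff_slice ht₁).of_le (by norm_cast)
  · have hps : ContDiff ℝ (⊤ : ℕ∞) (p t₁) :=
      hp.smooth_pressure.comp_contDiff (contDiff_prodMk_right t₁)
        fun x => mk_mem_prod hmem (mem_univ x)
    exact hps.of_le (by norm_cast)
  · intro y
    have hmom := hp.momentum t₁ hmem y
    have htd : timeDerivWithin (Ioo (2 * t₁) 0) u t₁ y = timeDeriv u t₁ y := by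
      simp only [timeDerivWithin_apply, timeDeriv_apply]
      exact derivWithin_of_isOpen isOpen_Ioo hmem
    rw [htd] at hmom
    have hκ0 : κ ≠ 0 := hκ.ne
    have hd : timeDeriv u t₁ y = (-κ⁻¹) • (fderiv ℝ (u t₁) y y + u t₁ y) := by
      have h1 : κ • timeDeriv u t₁ y = -(fderiv ℝ (u t₁) y y + u t₁ y) := by
        rw [eq_neg_iff_add_eq_zero, add_comm]; exact h y
      calc timeDeriv u t₁ y = κ⁻¹ • (κ • timeDeriv u t₁ y) := by rw [inv_smul_smul₀ hκ0]
        _ = (-κ⁻¹) • (fderiv ℝ (u t₁) y y + u t₁ y) := by rw [h1, smul_neg, neg_smul]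
    rw [hd] at hmom
    simp only [Pi.zero_apply, add_zero, one_smul] at hmom
    rw [← sub_eq_zero] at hmom
    rw [← hmom]
    simp only [smul_add, one_smul]
    abel

/-- **SCALING LAW (vertex in the future of the slice, whole slice).** Under the hypotheses of
`lerayProfile_of_scalingSlice`, `u ≡ 0` on the past: the slice is a BOUNDED Leray profile (Type-I
bound `C/√(−t₁)`), hence CONSTANT by Tsai's theorem BY NAME
(`IsLerayProfile.exists_eq_const_of_bounded`, `q = ∞`), and a constant slice kills a class element
(`sliceConstLiouville`). -/
theorem eq_zero_of_scalingSlice (hu : IsTypeIAncientMild C u) {t₁ : ℝ} (ht₁ : t₁ < 0)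
    {κ : ℝ} (hκ : κ < 0)
    (h : ∀ y, fderiv ℝ (u t₁) y y + u t₁ y + κ • timeDeriv u t₁ y = 0) :
    ∀ t < 0, ∀ x, u t x = 0 := by
  obtain ⟨P, hprof⟩ := lerayProfile_of_scalingSlice hu ht₁ hκ h
  have ha : 0 < -κ⁻¹ := by rw [neg_pos]; exact inv_lt_zero.2 hκ
  obtain ⟨c, hc⟩ := hprof.exists_eq_const_of_bounded one_pos ha
    ⟨C / Real.sqrt (-t₁), fun y => hu.norm_le ht₁ y⟩
  exact sliceConstLiouville hu ht₁ hc

end Summit.NavierStokesRegularity.NavierStokesRegularity.Theorems.ScenarioCensus.GeneratorMeter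

end
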